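/-
Copyright (c) 2026. All rights reserved.
Released under Apache 2.0 license as described in the file LICENSE.
-/
import Literature.NumberTheory.ComplexMultiplication.DegenerateCMTypesCyclicPrimePowerExistence
import Literature.NumberTheory.ComplexMultiplication.DegenerateCMTypesCyclicTwoOddPrimesCount
import HarnessLib

/-!
# The CM types of the cyclic group of order `2p^k`, counted by levels: `2^{p^k}` types,
# `(Σ_m C(p^{k−i−1}, m)^p)^{p^i}` equidistributed at level `i + 1`, `2^{p^{k−1}}` imprimitive;
# the census of `⟨ρ⟩ × ℤ₂₇`

Sequel to `DegenerateCMTypesCyclicPrimePower` (ranks by levels) and `…PrimePowerExistence` (exponent sets), in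
the pattern of `DegenerateCMTypesCyclicPrimeSquareCount` (`k = 2`) and of Hazama's counts
(`DegenerateCMTypesCyclicTwoOddPrimesCount`, whose `card_filter_rows_card_const` — "the `q × p` `(0,1)`-matrices
with constant row sum number `Σ C(p,i)^q`" — is REUSED).  F. Hazama [Hazama2003CyclicCM], Prop. 4.3 (the count
`#S_p`), Thm. 4.8; B. Dodson [Dodson1987], Prop. 4.4 (1) (`⟨ρ⟩ × ℤ₉`: `512` types `f ∈ ℤ₂⁹`), Remark 4.5.

THE COUNT.  A CM type `S` of `⟨ρ⟩ × ⟨σ⟩` (`σ` of order `p^k`) is its exponent set `R = {b : σᵇ ∈ S} ⊆ ℤ/p^k`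
(`2^{p^k}` types).  In the digits `b = p^{i+1}x + c` the set `R` is a column function `c ↦ R_c ⊆ ℤ/p^{k−i−1}`
(`c ∈ ℤ/p^{i+1}`), and `S` is equidistributed at level `i + 1` iff `#R_{c+p^i} = #R_c` for all `c`, i.e. iff in
each of the `p^i` classes `c ≡ y (mod p^i)` the `p` columns have a common size: `(Σ_{m} C(p^{k−i−1}, m)^p)^{p^i}`
such `R`.  Level `k` (`σ^{p^{k−1}}S = S`): `(C(1,0)^p + C(1,1)^p)^{p^{k−1}} = 2^{p^{k−1}}`.

## What is PROVED (theorems only; no definition, no named fact, no `sorry`)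

* §1 (private) digit bijections, `columns_bijective`, `curry_bijective`, `card_filter_pi_eq_pow`.
* §2 **`ncard_cmTypes_sep_eq_card_filter`** (transport `S ↦ R(S)` for agreeing predicates), **`ncard_cmTypes`**
  (`2^{p^k}`).
* §3 **`ncard_level`** (`#{S : level i+1} = (Σ_{m ≤ p^{k−i−1}} C(p^{k−i−1}, m)^p)^{p^i}`), **`ncard_isStableUnder`**
  (`2^{p^{k−1}}` imprimitive types), **`ncard_primitive`** (`2^{p^k} − 2^{p^{k−1}}`).
* §4 **`census_twentySeven`** (`⟨ρ⟩ × ℤ₂₇`: `134217728` types; `5280932` at level `1`, `175616 = 56³` at level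
  `2`, `512` imprimitive, `134217216` primitive).

NOT here: the joint distribution of the levels (the number of types of each RANK for `k ≥ 3` needs
inclusion–exclusion over the levels; for `k = 2` it is `DegenerateCMTypesCyclicPrimeSquareCount.ncard_typeRank_eq`).

## References

* [Hazama2003CyclicCM] F. Hazama, J. Math. Sci. Univ. Tokyo 10 (2003): Prop. 4.1, Prop. 4.3, Prop. 4.7, Thm. 4.8.
* [Dodson1987] B. Dodson, J. Algebra 111 (1987) 49–73: §1.1, Prop. 4.1, Prop. 4.4 (1), Remark 4.5.
* [Kubota1965] T. Kubota, Trans. AMS 118 (1965), §4 Lemma 2.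

## Provenance

Lane `lit-hodgefound` (Track 2, Layer A3 — CM types), seat `lit-hodgefound-p10` generation 35, row g35-#13;
neighbours cited by name, nothing restated: `DegenerateCMTypesCyclicPrimePowerExistence`
(`rowCount_eq_card_filter`, `exists_isCMTypeWith_exponents`), `DegenerateCMTypesCyclicPrimePower`
(`exists_coord`, `level_top_iff_isStableUnder`, `forall_not_isStableUnder_iff`),
`DegenerateCMTypesCyclicTwoOddPrimesCount` (`card_filter_rows_card_const`).
-/

open scoped BigOperators

namespace Literature.NumberTheory.ComplexMultiplication

namespace CyclicCMType

namespace PrimePow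

/-! ## §1 Digits (private counting lemmas) -/

section Digits

variable {A B n : ℕ} [hA : NeZero A] [hB : NeZero B] [hn0 : NeZero n]

omit hA hB hn0 in
/-- Digits are unique. [folklore] -/
private theorem digits_inj' {x x' c c' : ℕ} (hc : c < B) (hc' : c' < B) (h : B * x + c = B * x' + c') :
    x = x' ∧ c = c' := by
  have hB0 : 0 < B := by omega
  have e2 : c = c' := by
    have := congrArg (· % B) h
    simpa only [Nat.mul_add_mod, Nat.mod_eq_of_lt hc, Nat.mod_eq_of_lt hc'] using this
  have e1 : x = x' := by
    have := congrArg (· / B) h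
    simpa only [Nat.mul_add_div hB0, Nat.div_eq_of_lt hc, Nat.div_eq_of_lt hc', add_zero] using this
  exact ⟨e1, e2⟩

omit hA hB hn0 in
/-- `Bx + c < AB`. [folklore] -/
private theorem digits_lt' {x c : ℕ} (hx : x < A) (hc : c < B) : B * x + c < A * B := by
  have h1 : B * x + c < B * x + B := by omega
  have h2 : B * x + B = B * (x + 1) := by ring
  have h3 : B * (x + 1) ≤ B * A := Nat.mul_le_mul_left B hx
  rw [mul_comm A B]; omega

omit hn0 in
/-- The digit map `ℤ/A × ℤ/B → ℤ/AB` is a bijection. [folklore] -/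
private theorem digit_bijective' [NeZero n] (hn : n = A * B) :
    Function.Bijective fun xc : ZMod A × ZMod B => ((B * xc.1.val + xc.2.val : ℕ) : ZMod n) := by
  subst hn
  rw [Fintype.bijective_iff_injective_and_card]
  refine ⟨?_, by rw [Fintype.card_prod, ZMod.card, ZMod.card, ZMod.card]⟩
  rintro ⟨x, c⟩ ⟨x', c'⟩ h
  simp only at h
  rw [ZMod.natCast_eq_natCast_iff'] at h
  rw [Nat.mod_eq_of_lt (digits_lt' (ZMod.val_lt x) (ZMod.val_lt c)),
    Nat.mod_eq_of_lt (digits_lt' (ZMod.val_lt x') (ZMod.val_lt c'))] at h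
  obtain ⟨e1, e2⟩ := digits_inj' (ZMod.val_lt c) (ZMod.val_lt c') h
  exact Prod.ext (ZMod.val_injective A e1) (ZMod.val_injective B e2)

omit hB hn0 in
/-- Incrementing the high digit adds `B`. [folklore] -/
private theorem digit_succ' [NeZero n] (hn : n = A * B) (x : ZMod A) (c : ZMod B) :
    (((B * (x + 1).val + c.val : ℕ) : ZMod n)) = ((B * x.val + c.val : ℕ) : ZMod n) + B := by
  subst hn
  have hAB : (A : ZMod (A * B)) * B = 0 := by exact_mod_cast ZMod.natCast_self (A * B)
  have hval : (x + 1).val + A * ((x.val + 1) / A) = x.val + 1 := by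
    rw [ZMod.val_add, ZMod.val_one_eq_one_mod, Nat.add_mod_mod]
    exact Nat.mod_add_div _ _
  have hcast := congrArg (Nat.cast : ℕ → ZMod (A * B)) hval
  push_cast at hcast ⊢
  have e : ((x + 1).val : ZMod (A * B)) = x.val + 1 - A * (((x.val + 1) / A : ℕ) : ZMod (A * B)) := by
    rw [← hcast]; ring
  rw [e]
  linear_combination (-(((x.val + 1) / A : ℕ) : ZMod (A * B))) * hAB

omit hA hB hn0 in
/-- Counting through a bijection. [folklore] -/
private theorem card_filter_comp_eq' {α β : Type*} [Fintype α] [Fintype β] [DecidableEq β] {e : α → β}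
    (he : Function.Bijective e) (P : β → Prop) [DecidablePred P] :
    (Finset.univ.filter fun a => P (e a)).card = (Finset.univ.filter P).card := by
  refine Finset.card_bij (fun a _ => e a) (fun a ha => ?_) (fun a _ a' _ h => he.1 h) fun b hb => ?_
  · exact Finset.mem_filter.2 ⟨Finset.mem_univ _, (Finset.mem_filter.1 ha).2⟩
  · obtain ⟨a, rfl⟩ := he.2 b
    exact ⟨a, Finset.mem_filter.2 ⟨Finset.mem_univ _, (Finset.mem_filter.1 hb).2⟩, rfl⟩

omit hA hB hn0 in
/-- Iterating a period. [folklore] -/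
private theorem periodic_nsmul'' {M : Type*} [AddCommMonoid M] {N : M → ℕ} {d : M} (hN : ∀ c, N (c + d) = N c)
    (c : M) (m : ℕ) : N (c + m • d) = N c := by
  induction m with
  | zero => rw [zero_smul, add_zero]
  | succ m ih => rw [succ_nsmul, ← add_assoc, hN, ih]

omit hn0 in
/-- **Subsets of `ℤ/AB` versus column functions `ℤ/B → 𝒫(ℤ/A)`** (`R ↦ (c ↦ {x : Bx + c ∈ R})` is a
bijection). [folklore] -/
private theorem columns_bijective [NeZero n] (hn : n = A * B) :
    Function.Bijective fun R : Finset (ZMod n) => fun c : ZMod B =>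
      Finset.univ.filter fun x : ZMod A => ((B * x.val + c.val : ℕ) : ZMod n) ∈ R := by
  classical
  have hd := digit_bijective' (A := A) (B := B) hn
  rw [Fintype.bijective_iff_injective_and_card]
  refine ⟨fun R R' h => ?_, ?_⟩
  · ext b
    obtain ⟨⟨x, c⟩, rfl⟩ := hd.2 b
    have := congrArg (fun r : ZMod B → Finset (ZMod A) => x ∈ r c) h
    simpa using this
  · rw [Fintype.card_finset, Fintype.card_fun, Fintype.card_finset, ZMod.card, ZMod.card, ZMod.card, hn,
      ← pow_mul]

omit hn0 in
/-- **Functions on `ℤ/AB` versus families over the low digit**: `r ↦ (y ↦ (u ↦ r(By… )))` — precomposition with the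
digit bijection `ℤ/A × ℤ/B → ℤ/AB`, curried — is a bijection. [folklore] -/
private theorem curry_bijective [NeZero n] (hn : n = A * B) (X : Type*) :
    Function.Bijective fun r : ZMod n → X => fun (c : ZMod B) (x : ZMod A) =>
      r ((B * x.val + c.val : ℕ) : ZMod n) := by
  have hd := digit_bijective' (A := A) (B := B) hn
  constructor
  · intro r r' h
    funext b
    obtain ⟨⟨x, c⟩, rfl⟩ := hd.2 b
    have := congrFun (congrFun h c) x
    simpa using this
  · intro f
    refine ⟨fun b => f (Function.surjInv hd.2 b).2 (Function.surjInv hd.2 b).1, ?_⟩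
    funext c x
    simp only
    have : Function.surjInv hd.2 (((B * x.val + c.val : ℕ) : ZMod n)) = (x, c) :=
      hd.1 (Function.surjInv_eq hd.2 _)
    rw [this]

omit hA hB hn0 in
/-- **Counting families with a componentwise constraint**: `#{f : Y → Z | ∀ y, C (f y)} = #{z | C z}^{#Y}`. [folklore] -/
private theorem card_filter_pi_eq_pow {Y Z : Type*} [Fintype Y] [DecidableEq Y] [Fintype Z] [DecidableEq Z]
    (C : Z → Prop) [DecidablePred C] :
    (Finset.univ.filter fun f : Y → Z => ∀ y, C (f y)).card = (Finset.univ.filter C).card ^ Fintype.card Y := by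
  classical
  have h1 : (Finset.univ.filter fun f : Y → Z => ∀ y, C (f y)).card = Fintype.card {f : Y → Z // ∀ y, C (f y)} :=
    (Fintype.card_subtype _).symm
  have h2 : (Finset.univ.filter C).card = Fintype.card {z : Z // C z} := (Fintype.card_subtype _).symm
  rw [h1, h2, Fintype.card_congr (Equiv.subtypePiEquivPi (p := fun _ : Y => C)), Fintype.card_fun]

end Digits

/-! ## §2 Transport: CM types of `⟨ρ⟩ × ⟨σ⟩` versus exponent sets `R ⊆ ℤ/p^k` -/

section Transport

variable {G : Type*} [CommGroup G] [Fintype G] [DecidableEq G] {p : ℕ} [hp : Fact p.Prime] {k : ℕ} {ρ σ : G}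

/-- Counting a set cut out by a decidable predicate. [folklore] -/
private theorem ncard_setOf_eq_card_filter'' {α : Type*} [Fintype α] (P : α → Prop) [DecidablePred P] :
    {a : α | P a}.ncard = (Finset.univ.filter P).card := by
  rw [← Set.ncard_coe_finset]
  congr 1
  ext a
  simp

/-- **Transport of counts along `S ↦ R(S) = {b : σᵇ ∈ S}`**: for predicates `P` on types and `Q` on exponent sets
that agree, `#{S CM type : P(S)} = #{R ⊆ ℤ/p^k : Q(R)}` — Dodson's identification of the types on `⟨ρ⟩ × ℤ_{p^k}`
with `f ∈ ℤ₂^{p^k}`. [cite: Dodson1987, §1.1 and Prop. 4.1] -/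
theorem ncard_cmTypes_sep_eq_card_filter (hσ : orderOf σ = p ^ k) (hρσ : ρ ∉ Subgroup.zpowers σ)
    (hcard : Fintype.card G = 2 * p ^ k) (hρ2 : ρ * ρ = 1) (P : Finset G → Prop)
    (Q : Finset (ZMod (p ^ k)) → Prop) [DecidablePred Q]
    (hPQ : ∀ (Φ : Finset G) (R : Finset (ZMod (p ^ k))), IsCMTypeWith ρ (Φ : Set G) →
      (∀ b : ZMod (p ^ k), σ ^ b.val ∈ Φ ↔ b ∈ R) → (P Φ ↔ Q R)) :
    {Φ : Finset G | IsCMTypeWith ρ (Φ : Set G) ∧ P Φ}.ncard = (Finset.univ.filter Q).card := by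
  classical
  have hσ' : orderOf σ = 1 * p ^ k := by rw [one_mul, hσ]
  have hcard' : Fintype.card G = 2 * (1 * p ^ k) := by rw [one_mul, hcard]
  have hσk : σ ^ p ^ k = 1 := by rw [← hσ]; exact pow_orderOf_eq_one σ
  rw [ncard_setOf_eq_card_filter'']
  have hf : ∀ Φ : Finset G, ∀ b : ZMod (p ^ k),
      σ ^ b.val ∈ Φ ↔ b ∈ Finset.univ.filter fun b : ZMod (p ^ k) => σ ^ b.val ∈ Φ := fun Φ b => by simp
  refine Finset.card_bij (fun Φ _ => Finset.univ.filter fun b : ZMod (p ^ k) => σ ^ b.val ∈ Φ)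
    (fun Φ hΦ => ?_) (fun Φ₁ h₁ Φ₂ h₂ h => ?_) (fun R hR => ?_)
  · rw [Finset.mem_filter] at hΦ ⊢
    exact ⟨Finset.mem_univ _, (hPQ Φ _ hΦ.2.1 (hf Φ)).1 hΦ.2.2⟩
  · rw [Finset.mem_filter] at h₁ h₂
    ext g
    obtain ⟨⟨a, c⟩, rfl | rfl⟩ := exists_coord hσ' hρσ hcard' g
    · simp only [hσk, one_pow, one_mul]
      rw [hf Φ₁, hf Φ₂, h]
    · simp only [hσk, one_pow, one_mul]
      rw [rho_mul_mem_iff h₁.2.1, rho_mul_mem_iff h₂.2.1, hf Φ₁, hf Φ₂, h]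
  · rw [Finset.mem_filter] at hR
    obtain ⟨Φ, h, hRΦ⟩ := exists_isCMTypeWith_exponents hσ hρσ hcard hρ2 R
    have hfR : (Finset.univ.filter fun b : ZMod (p ^ k) => σ ^ b.val ∈ Φ) = R := by
      ext b; rw [← hf Φ, hRΦ]
    refine ⟨Φ, ?_, hfR⟩
    rw [Finset.mem_filter]
    exact ⟨Finset.mem_univ _, h, (hPQ Φ R h hRΦ).2 hR.2⟩

/-- **There are `2^{p^k}` CM types for `ρ`** on `⟨ρ⟩ × ℤ_{p^k}` (Dodson's `f ∈ ℤ₂^{p^k}`).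
[cite: Dodson1987, §1.1 and Prop. 4.1] -/
theorem ncard_cmTypes (hσ : orderOf σ = p ^ k) (hρσ : ρ ∉ Subgroup.zpowers σ)
    (hcard : Fintype.card G = 2 * p ^ k) (hρ2 : ρ * ρ = 1) :
    {Φ : Finset G | IsCMTypeWith ρ (Φ : Set G)}.ncard = 2 ^ (p ^ k) := by
  classical
  have h := ncard_cmTypes_sep_eq_card_filter hσ hρσ hcard hρ2 (fun _ => True) (fun _ => True)
    fun _ _ _ _ => Iff.rfl
  simp only [and_true, Finset.filter_true_of_mem (fun _ _ => trivial), Finset.card_univ, Fintype.card_finset,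
    ZMod.card] at h
  exact h

end Transport

/-! ## §3 The number of types equidistributed at a given level -/

section Levels

variable {G : Type*} [CommGroup G] [Fintype G] [DecidableEq G] {p : ℕ} [hp : Fact p.Prime] {k : ℕ} {ρ σ : G}

/-- **Column functions with `d`-periodic column sizes, `B = p·q`, `d = q`**: their number is
`(Σ_{0≤m≤A} C(A,m)^p)^q` — for each low digit `y ∈ ℤ/q` the `p` columns `y, y+q, …` have a common size.
[cite: Hazama2003CyclicCM, Prop. 4.3 (the count)] -/
private theorem card_filter_columns_periodic (A q : ℕ) [NeZero A] [NeZero q] {B : ℕ} [NeZero B] (hB : B = p * q) :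
    (Finset.univ.filter fun r : ZMod B → Finset (ZMod A) =>
      ∀ c : ZMod B, (r (c + (q : ZMod B))).card = (r c).card).card =
      (∑ m ∈ Finset.range (A + 1), A.choose m ^ p) ^ q := by
  classical
  -- pass to families over the low digit `y ∈ ℤ/q` of `p`-tuples (high digit `u ∈ ℤ/p`)
  have hcur := curry_bijective (A := p) (B := q) hB (Finset (ZMod A))
  have hpi := card_filter_pi_eq_pow (Y := ZMod q) (Z := ZMod p → Finset (ZMod A))
    (fun t => ∀ u u' : ZMod p, (t u).card = (t u').card)
  rw [ZMod.card] at hpi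
  rw [← card_filter_rows_card_const A p, ← hpi, ← card_filter_comp_eq' hcur]
  congr 1
  refine Finset.filter_congr fun r _ => ?_
  simp only
  constructor
  · intro H y u u'
    have e : ∀ v : ZMod p, ((q * v.val + y.val : ℕ) : ZMod B) = (y.val : ZMod B) + v.val • (q : ZMod B) := by
      intro v; push_cast; rw [nsmul_eq_mul]; ring
    have h1 : (r ((y.val : ZMod B) + u.val • (q : ZMod B))).card = (r (y.val : ZMod B)).card :=
      periodic_nsmul'' (N := fun c => (r c).card) H (y.val : ZMod B) u.val
    have h2 : (r ((y.val : ZMod B) + u'.val • (q : ZMod B))).card = (r (y.val : ZMod B)).card :=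
      periodic_nsmul'' (N := fun c => (r c).card) H (y.val : ZMod B) u'.val
    rw [e, e, h1, h2]
  · intro H c
    obtain ⟨⟨u, y⟩, rfl⟩ := (digit_bijective' (A := p) (B := q) hB).2 c
    simp only
    rw [← digit_succ' hB u y]
    exact H y (u + 1) u

/-- **THE NUMBER OF CM TYPES OF `⟨ρ⟩ × ℤ_{p^k}` EQUIDISTRIBUTED AT LEVEL `i + 1`** (`i < k`): the class on which
the `φ(p^{i+1})` odd characters of order `2p^{i+1}` vanish has
`(Σ_{0 ≤ m ≤ p^{k−i−1}} C(p^{k−i−1}, m)^p)^{p^i}` elements — inside each of the `p^i` cosets of `⟨σ^{p^i}⟩` the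
`p` cosets of `⟨σ^{p^{i+1}}⟩` (of size `p^{k−i−1}`) carry subsets of a common size.  For `k = 2`, `i = 0`:
Hazama's `#S_p = Σ C(p,m)^p` (`56` for `p = 3`); `i = k − 1`: `2^{p^{k−1}}` imprimitive types.
[cite: Hazama2003CyclicCM, Prop. 4.3 and Thm. 4.8] [cite: Dodson1987, Prop. 4.4 (1)] -/
theorem ncard_level (hσ : orderOf σ = p ^ k) (hρσ : ρ ∉ Subgroup.zpowers σ) (hcard : Fintype.card G = 2 * p ^ k)
    (hρ2 : ρ * ρ = 1) {i : ℕ} (hi : i < k) :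
    {Φ : Finset G | IsCMTypeWith ρ (Φ : Set G) ∧ ∀ c : ZMod (p ^ (i + 1)),
      rowCount (p ^ (k - (i + 1))) (p ^ (i + 1)) Φ (σ ^ p ^ (i + 1)) σ (c + (p ^ i : ℕ)) =
        rowCount (p ^ (k - (i + 1))) (p ^ (i + 1)) Φ (σ ^ p ^ (i + 1)) σ c}.ncard =
      (∑ m ∈ Finset.range (p ^ (k - (i + 1)) + 1), (p ^ (k - (i + 1))).choose m ^ p) ^ (p ^ i) := by
  classical
  have hn : p ^ k = p ^ (k - (i + 1)) * p ^ (i + 1) := by rw [← pow_add, Nat.sub_add_cancel hi]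
  -- exponent sets `R`, then column functions
  rw [ncard_cmTypes_sep_eq_card_filter hσ hρσ hcard hρ2 _
    (fun R : Finset (ZMod (p ^ k)) => ∀ c : ZMod (p ^ (i + 1)),
      (Finset.univ.filter fun x : ZMod (p ^ (k - (i + 1))) =>
        ((p ^ (i + 1) * x.val + (c + (p ^ i : ℕ)).val : ℕ) : ZMod (p ^ k)) ∈ R).card =
      (Finset.univ.filter fun x : ZMod (p ^ (k - (i + 1))) =>
        ((p ^ (i + 1) * x.val + c.val : ℕ) : ZMod (p ^ k)) ∈ R).card)
    (fun Φ R _ hR => by simp_rw [rowCount_eq_card_filter hσ hR i]),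
    ← card_filter_columns_periodic (p ^ (k - (i + 1))) (p ^ i) (pow_succ' p i),
    ← card_filter_comp_eq' (columns_bijective (A := p ^ (k - (i + 1))) (B := p ^ (i + 1)) hn)]

/-- **`2^{p^{k−1}}` IMPRIMITIVE TYPES** (`σ^{p^{k−1}}S = S`: induced from the quotient of order `2p^{k−1}`).
[cite: Dodson1987, Prop. 4.4 (1)] [cite: Hazama2003CyclicCM, Prop. 4.7] -/
theorem ncard_isStableUnder (hp2 : p ≠ 2) {m : ℕ} (hσ : orderOf σ = p ^ (m + 1)) (hρσ : ρ ∉ Subgroup.zpowers σ)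
    (hcard : Fintype.card G = 2 * p ^ (m + 1)) (hρ2 : ρ * ρ = 1) :
    {Φ : Finset G | IsCMTypeWith ρ (Φ : Set G) ∧ IsStableUnder Φ (σ ^ p ^ m)}.ncard = 2 ^ (p ^ m) := by
  classical
  have key := ncard_level hσ hρσ hcard hρ2 (Nat.lt_succ_self m)
  have hset : {Φ : Finset G | IsCMTypeWith ρ (Φ : Set G) ∧ IsStableUnder Φ (σ ^ p ^ m)} =
      {Φ : Finset G | IsCMTypeWith ρ (Φ : Set G) ∧ ∀ c : ZMod (p ^ (m + 1)),
        rowCount (p ^ (m + 1 - (m + 1))) (p ^ (m + 1)) Φ (σ ^ p ^ (m + 1)) σ (c + (p ^ m : ℕ)) =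
          rowCount (p ^ (m + 1 - (m + 1))) (p ^ (m + 1)) Φ (σ ^ p ^ (m + 1)) σ c} := by
    ext Φ
    simp only [Set.mem_setOf_eq]
    constructor
    · rintro ⟨h, hs⟩; exact ⟨h, (level_top_iff_isStableUnder hσ hρσ hcard h).2 hs⟩
    · rintro ⟨h, hL⟩; exact ⟨h, (level_top_iff_isStableUnder hσ hρσ hcard h).1 hL⟩
  have _ := hp2
  rw [hset, key, Nat.sub_self, pow_zero]
  norm_num [Finset.sum_range_succ]

/-- **PRIMITIVE TYPES: `2^{p^k} − 2^{p^{k−1}}`.** [cite: Dodson1987, Prop. 4.4 (1)] [cite: Hazama2003CyclicCM, Thm. 4.8 (iii)] -/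
theorem ncard_primitive (hp2 : p ≠ 2) {m : ℕ} (hσ : orderOf σ = p ^ (m + 1)) (hρσ : ρ ∉ Subgroup.zpowers σ)
    (hcard : Fintype.card G = 2 * p ^ (m + 1)) (hρ2 : ρ * ρ = 1) :
    {Φ : Finset G | IsCMTypeWith ρ (Φ : Set G) ∧ ∀ u : G, u ≠ 1 → ¬ IsStableUnder Φ u}.ncard =
      2 ^ (p ^ (m + 1)) - 2 ^ (p ^ m) := by
  classical
  have htot := ncard_cmTypes hσ hρσ hcard hρ2
  have hst := ncard_isStableUnder hp2 hσ hρσ hcard hρ2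
  have hsplit : {Φ : Finset G | IsCMTypeWith ρ (Φ : Set G)} =
      {Φ : Finset G | IsCMTypeWith ρ (Φ : Set G) ∧ ∀ u : G, u ≠ 1 → ¬ IsStableUnder Φ u} ∪
        {Φ : Finset G | IsCMTypeWith ρ (Φ : Set G) ∧ IsStableUnder Φ (σ ^ p ^ m)} := by
    ext Φ
    simp only [Set.mem_setOf_eq, Set.mem_union]
    constructor
    · intro h
      by_cases hs : IsStableUnder Φ (σ ^ p ^ m)
      · exact Or.inr ⟨h, hs⟩
      · refine Or.inl ⟨h, ?_⟩
        have := (forall_not_isStableUnder_iff hp2 hσ (Nat.le_add_left 1 m) hρσ hcard h).2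
        rw [Nat.add_sub_cancel] at this
        exact this hs
    · rintro (⟨h, -⟩ | ⟨h, -⟩) <;> exact h
  have hdisj : Disjoint {Φ : Finset G | IsCMTypeWith ρ (Φ : Set G) ∧ ∀ u : G, u ≠ 1 → ¬ IsStableUnder Φ u}
      {Φ : Finset G | IsCMTypeWith ρ (Φ : Set G) ∧ IsStableUnder Φ (σ ^ p ^ m)} := by
    rw [Set.disjoint_left]
    rintro Φ ⟨h, hprim⟩ ⟨-, hs⟩
    have hne : σ ^ p ^ m ≠ 1 := by
      have := (forall_not_isStableUnder_iff hp2 hσ (Nat.le_add_left 1 m) hρσ hcard h).1 hprim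
      rw [Nat.add_sub_cancel] at this
      intro h1; rw [h1] at this; exact this fun g => by rw [one_mul]
    exact hprim _ hne hs
  have hfin : Set.Finite {Φ : Finset G | IsCMTypeWith ρ (Φ : Set G) ∧ IsStableUnder Φ (σ ^ p ^ m)} :=
    Set.toFinite _
  have hfin' : Set.Finite {Φ : Finset G | IsCMTypeWith ρ (Φ : Set G) ∧ ∀ u : G, u ≠ 1 → ¬ IsStableUnder Φ u} :=
    Set.toFinite _
  rw [hsplit, Set.ncard_union_eq hdisj hfin' hfin, hst] at htot
  omega

end Levels

/-! ## §4 `p^k = 27`: the census of the `2²⁷` CM types of `⟨ρ⟩ × ℤ₂₇` by levels -/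

section TwentySeven

variable {G : Type*} [CommGroup G] [Fintype G] [DecidableEq G] {ρ σ : G}

/-- `Σ_{m ≤ 9} C(9,m)³ = 5280932`. [folklore] -/
private theorem sum_choose_nine_cube : ∑ m ∈ Finset.range (9 + 1), (9 : ℕ).choose m ^ 3 = 5280932 := by
  decide

/-- `Σ_{m ≤ 3} C(3,m)³ = 56`. [folklore] -/
private theorem sum_choose_three_cube : ∑ m ∈ Finset.range (3 + 1), (3 : ℕ).choose m ^ 3 = 56 := by
  decide

/-- **The census of the `134217728 = 2²⁷` CM types of `⟨ρ⟩ × ℤ₂₇` by levels**: `5280932` equidistributed at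
level `1` (equal counts on the three cosets of `⟨σ³⟩`), `175616 = 56³` at level `2`, `512 = 2⁹` at level `3`
(imprimitive), hence `134217216` primitive. [cite: Dodson1987, Prop. 4.4 (1) and Remark 4.5]
[cite: Hazama2003CyclicCM, Prop. 4.3] -/
theorem census_twentySeven (hσ : orderOf σ = 27) (hρσ : ρ ∉ Subgroup.zpowers σ) (hcard : Fintype.card G = 54)
    (hρ2 : ρ * ρ = 1) :
    {Φ : Finset G | IsCMTypeWith ρ (Φ : Set G)}.ncard = 134217728 ∧
    {Φ : Finset G | IsCMTypeWith ρ (Φ : Set G) ∧ ∀ c : ZMod (3 ^ (0 + 1)),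
      rowCount (3 ^ (2 + 1 - (0 + 1))) (3 ^ (0 + 1)) Φ (σ ^ 3 ^ (0 + 1)) σ (c + ((3 ^ 0 : ℕ) : ZMod (3 ^ (0 + 1)))) =
        rowCount (3 ^ (2 + 1 - (0 + 1))) (3 ^ (0 + 1)) Φ (σ ^ 3 ^ (0 + 1)) σ c}.ncard = 5280932 ∧
    {Φ : Finset G | IsCMTypeWith ρ (Φ : Set G) ∧ ∀ c : ZMod (3 ^ (1 + 1)),
      rowCount (3 ^ (2 + 1 - (1 + 1))) (3 ^ (1 + 1)) Φ (σ ^ 3 ^ (1 + 1)) σ (c + ((3 ^ 1 : ℕ) : ZMod (3 ^ (1 + 1)))) =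
        rowCount (3 ^ (2 + 1 - (1 + 1))) (3 ^ (1 + 1)) Φ (σ ^ 3 ^ (1 + 1)) σ c}.ncard = 175616 ∧
    {Φ : Finset G | IsCMTypeWith ρ (Φ : Set G) ∧ IsStableUnder Φ (σ ^ 9)}.ncard = 512 ∧
    {Φ : Finset G | IsCMTypeWith ρ (Φ : Set G) ∧ ∀ u : G, u ≠ 1 → ¬ IsStableUnder Φ u}.ncard = 134217216 := by
  haveI : Fact (Nat.Prime 3) := ⟨Nat.prime_three⟩
  have hσ' : orderOf σ = 3 ^ (2 + 1) := by rw [hσ]; norm_num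
  have hcard' : Fintype.card G = 2 * 3 ^ (2 + 1) := by rw [hcard]; norm_num
  refine ⟨?_, ?_, ?_, ?_, ?_⟩
  · rw [ncard_cmTypes hσ' hρσ hcard' hρ2]; norm_num
  · rw [ncard_level hσ' hρσ hcard' hρ2 (by norm_num : 0 < 2 + 1)]
    norm_num [sum_choose_nine_cube]
  · rw [ncard_level hσ' hρσ hcard' hρ2 (by norm_num : 1 < 2 + 1)]
    norm_num [sum_choose_three_cube]
  · have := ncard_isStableUnder (p := 3) (by norm_num) hσ' hρσ hcard' hρ2
    norm_num at this
    exact this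
  · rw [ncard_primitive (p := 3) (by norm_num) hσ' hρσ hcard' hρ2]; norm_num

end TwentySeven

end PrimePow

end CyclicCMType

end Literature.NumberTheory.ComplexMultiplication
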